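import Summits.QuantumFields.BalabanUV.T4Continuum.Support.NE7K1LinTorusFloor
import Summits.QuantumFields.BalabanUV.T4Continuum.Support.NE7K1LinSchurKernelDecay

/-!
# NE7K1LinTorusEntries — row NE7 (node U5), candidate route HOM, path H1L, cell K1-lin(s): THE ENTRIES OF RUN B's TORUS CHART
# OPERATOR `H_B^𝕋` AND THE TORUS GEOMETRY OF THE CENTRED SUP-NORM (toward I3 ON THE TORUS — NEEDS-ESTIMATE #E1, B-E1's strip
# clauses (b′)(e′))

Lineage `b2b-balaban-t4-ne7-p2` (CRUX PROVER NE7 #2), generation 73; file 42 — the torus twin of `NE7K1LinWalkLineEntries` §3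
(file 11) for `H_B^𝕋 = torB = (L^{d+1})⁻¹·Tᵀ·torOpK (nL) 0 N·T` at `a = 0`.  B-E1's strip clauses need I3 ON THE TORUS: exponential
localisation of the doubled-torus line `T^𝕋(s)` in the TORUS distance.  The one geometric observation that makes file 28's
Combes–Thomas chain transpose verbatim: with the CENTRE `c₀ = (K_μ)_μ` of the representative box `boxDom (dbl K)` as base point,
the plain sup-norm `|x − c₀|_∞` IS the torus distance to `c₀`, and REDUCTION mod `2K` NEVER INCREASES IT (`|z mod 2K − K| ≤ |z − K|`),
so `x ↦ |x − c₀|_∞` is 1-Lipschitz along torus bonds (the wrap bond `2K−1 ~ 0` joins distances `K−1` and `K`).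

* §1 TORUS GEOMETRY: `abs_emod_sub_le` (`|z mod 2K − K| ≤ |z − K|`), `supNorm_wrap_sub_ctr_le`, `ctr_mem`, torus adjacency as
  `∃ z ∈ nbrs x, z mod 2K = y` ⟺ `tadj ≠ 0` (`exists_of_tadj_ne_zero ∕ tadj_ne_zero_of_exists`), the LIPSCHITZ facts
  `supNorm_sub_ctr_le_of_adj ∕ abs_supNorm_sub_ctr_sub_le` and the count `card_filter_tadj_le` (`≤ 2(d+1)` torus neighbours).
* §2 `H_B^𝕋` AT `a = 0`: `torOpK_zero_eq_smul_lap` (`torOpK n 0 N = n²·lap(tadj)`), `sum_abs_lap_tadj_le` (column `ℓ¹`-norm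
  `≤ 4(d+1)`), `torB_apply`, **`abs_torB_inr_le`** `|H_B^𝕋(c, inr q)| ≤ 8(d+1)(nL)²∕L^{d+1}` (and transposed),
  **`torB_zero_ne_zero_adj`**: a nonzero entry `H_B^𝕋(c, c′)` forces the coarse sites to be EQUAL or TORUS-ADJACENT,
  **`abs_torB_inl_inl_le`** `|H_B^𝕋(x, y)| ≤ 4(d+1)n²L²` on the coarse block.

HONEST FRAMING: [folklore] finite bookkeeping at the Gaussian `A = 0` level; crude constants; nothing of Bałaban's asserted; no
`sorry`.  Census only (helpers toward I3 on the torus — file 43); NO letter ∕ tag ∕ size of NE7 moves; NE7 NOT PRINTED ∕ NOT PROVED;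
spine 0∕9; FIXED FINITE T⁴, rung (B)+1; NOT infinite volume, NOT mass gap, NOT Clay.  HONEST DEPENDENCY: continuum YM on T⁴ ⇐
BetaPertH ∧ nine spine estimates (0/9 proved); BetaPertH ⇐ (D1) ∧ (D4) ∧ CAP+tail; G-an2-4 gates asym, D1 and NE2/3/4.
-/

noncomputable section

open Finset Matrix

namespace Summit.QuantumFields.BalabanUV.T4Continuum.NE7K1LinTorusEntries

open Literature.MathematicalPhysics.QuantumFieldTheory.Balaban1983to89
open Literature.MathematicalPhysics.QuantumFieldTheory.Balaban1983to89.B4ContourShift (supNorm supNorm_nonneg abs_le_supNorm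
  exists_supNorm_eq)
open Literature.MathematicalPhysics.QuantumFieldTheory.Balaban1983to89.B4Reflection242
open Literature.MathematicalPhysics.QuantumFieldTheory.Balaban1983to89.B4BoxCov237 (uvec)
open Literature.MathematicalPhysics.QuantumFieldTheory.Balaban1983to89.B4Lower18
open Literature.MathematicalPhysics.QuantumFieldTheory.Balaban1983to89.B4TorusPositivity (wrap wrap_wrap_add)
open Literature.MathematicalPhysics.QuantumFieldTheory.Balaban1983to89.Beta.CombesThomasForm (lap lap_apply lap_form)
open NE7K1LinFoldKernels NE7K1LinFoldMatrices NE7K1LinSchurFold NE7K1LinTorusChart NE7K1LinSchurFoldBox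
  NE7K1LinTorusLineInvariant NE7K1LinTorusLineSymbol NE7K1LinTorusSymbolReal NE7K1LinTorusJensen NE7K1LinTorusFloor
  NE7K1LinBlockCoords NE7K1LinSchurLineU1 NE7K1LinSchurLineForm NE7K1LinTwoRunKit NE7K1LinWalkLine
  NE7K1LinWalkLineEntries NE7K1LinWalkLineBlocks

variable {d : ℕ}

/-! ### §1 Torus geometry of the centred sup-norm -/

section Geometry

variable {K : Fin (d + 1) → ℕ}

/-- **REDUCTION mod `2K` NEVER MOVES AWAY FROM THE CENTRE**: `|z mod 2K − K| ≤ |z − K|` (`K ≥ 1`). [folklore] -/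
theorem abs_emod_sub_le {K : ℕ} (hK : 1 ≤ K) (z : ℤ) : |z % (2 * K : ℤ) - K| ≤ |z - K| := by
  have hK0 : (0 : ℤ) < 2 * K := by omega
  have h0 : 0 ≤ z % (2 * K : ℤ) := Int.emod_nonneg _ hK0.ne'
  have h1 : z % (2 * K : ℤ) < 2 * K := Int.emod_lt_of_pos _ hK0
  by_cases hz : 0 ≤ z ∧ z < 2 * K
  · rw [Int.emod_eq_of_lt hz.1 hz.2]
  · -- outside the box `|z − K| ≥ K ≥ |z mod 2K − K|`
    rw [abs_le]
    rw [not_and_or, not_le, not_lt] at hz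
    rcases hz with hz | hz
    · have : K ≤ |z - (K : ℤ)| := by rw [abs_of_neg (by omega)]; omega
      constructor <;> omega
    · have : K ≤ |z - (K : ℤ)| := by rw [abs_of_nonneg (by omega)]; omega
      constructor <;> omega

/-- hence `|wrap z − c₀|_∞ ≤ |z − c₀|_∞` for the centre `c₀ = (K_μ)`. [folklore] -/
theorem supNorm_wrap_sub_ctr_le (hK : ∀ i, 1 ≤ K i) (z : Fin (d + 1) → ℤ) :
    supNorm (wrap (dbl K) z - fun i => (K i : ℤ)) ≤ supNorm (z - fun i => (K i : ℤ)) := by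
  refine supNorm_le_of_forall fun i => le_trans ?_ (abs_le_supNorm _ i)
  have h := abs_emod_sub_le (hK i) (z i)
  have e : (wrap (dbl K) z - fun i => (K i : ℤ)) i = z i % (2 * K i : ℤ) - K i := by
    simp only [Pi.sub_apply, wrap, dbl_apply]; push_cast; ring_nf
  rw [e]
  exact_mod_cast h

/-- the centre is a representative. [folklore] -/
theorem ctr_mem (hK : ∀ i, 1 ≤ K i) : (fun i => (K i : ℤ)) ∈ boxDom (dbl K) := by
  rw [mem_boxDom]
  intro i
  have := hK i
  simp only [dbl_apply]
  push_cast
  constructor <;> linarith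

/-- torus adjacency: `tadj x y ≠ 0` iff some lattice neighbour of `x` reduces to `y`. [folklore] -/
theorem exists_of_tadj_ne_zero {x y : Fin (d + 1) → ℤ} (h : tadj K x y ≠ 0) : ∃ z ∈ nbrs x, wrap (dbl K) z = y := by
  classical
  unfold tadj at h
  obtain ⟨z, hz⟩ := Finset.card_pos.1 (Nat.pos_of_ne_zero h)
  exact ⟨z, (Finset.mem_filter.1 hz).1, (Finset.mem_filter.1 hz).2⟩

/-- and conversely. [folklore] -/
theorem tadj_ne_zero_of_exists {x y z : Fin (d + 1) → ℤ} (hz : z ∈ nbrs x) (hzy : wrap (dbl K) z = y) : tadj K x y ≠ 0 := by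
  classical
  unfold tadj
  exact (Finset.card_pos.2 ⟨z, Finset.mem_filter.2 ⟨hz, hzy⟩⟩).ne'

/-- **LIPSCHITZ ALONG TORUS BONDS**: a torus neighbour is at most one step farther from the centre. [folklore] -/
theorem supNorm_sub_ctr_le_of_adj (hK : ∀ i, 1 ≤ K i) {x y : Fin (d + 1) → ℤ} (h : tadj K x y ≠ 0) :
    supNorm (y - fun i => (K i : ℤ)) ≤ supNorm (x - fun i => (K i : ℤ)) + 1 := by
  obtain ⟨z, hz, rfl⟩ := exists_of_tadj_ne_zero h
  refine (supNorm_wrap_sub_ctr_le hK z).trans ?_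
  have e : (z - fun i => (K i : ℤ)) = (z - x) + (x - fun i => (K i : ℤ)) := by abel
  rw [e]
  refine (supNorm_add_le _ _).trans ?_
  have h1 : supNorm (z - x) ≤ 1 := by
    rw [← B4TorusKernel.supNorm_neg, neg_sub]; exact supNorm_sub_le_one_of_mem_nbrs hz
  linarith

/-- the symmetric Lipschitz statement on representatives: `| |x − c₀|_∞ − |y − c₀|_∞ | ≤ 1`. [folklore] -/
theorem abs_supNorm_sub_ctr_sub_le (hK : ∀ i, 1 ≤ K i) {x y : Fin (d + 1) → ℤ} (hx : x ∈ boxDom (dbl K))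
    (hy : y ∈ boxDom (dbl K)) (h : tadj K x y ≠ 0) :
    |supNorm (x - fun i => (K i : ℤ)) - supNorm (y - fun i => (K i : ℤ))| ≤ 1 := by
  have h1 := supNorm_sub_ctr_le_of_adj hK h
  have h2 := supNorm_sub_ctr_le_of_adj hK (x := y) (y := x) (by rwa [tadj_comm hy hx])
  rw [abs_le]; constructor <;> linarith

/-- a torus neighbour of the centre is within sup-distance one of it. [folklore] -/
theorem supNorm_sub_ctr_le_one_of_adj_ctr (hK : ∀ i, 1 ≤ K i) {y : Fin (d + 1) → ℤ}
    (h : tadj K (fun i => (K i : ℤ)) y ≠ 0) : supNorm (y - fun i => (K i : ℤ)) ≤ 1 := by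
  have := supNorm_sub_ctr_le_of_adj hK h
  rwa [sub_self, B4BoxCov237.supNorm_zero', zero_add] at this

variable {L : ℕ} [NeZero L] {T : Finset (Fin (d + 1) → ℤ)}

omit [NeZero L] in
/-- **AT MOST `2(d+1)` TORUS NEIGHBOURS** among the labels (each has multiplicity `≥ 1` in the total degree `2(d+1)`), in both
slots. [folklore] -/
theorem card_filter_tadj_le (hK : ∀ i, 1 ≤ K i) (hTc : T.image (blk L) = boxDom (dbl K)) (x : ↥(T.image (blk L))) :
    ((univ.filter fun b : ↥(T.image (blk L)) => tadj K x.1 b.1 ≠ 0).card : ℝ) ≤ 2 * ((d : ℝ) + 1) ∧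
      ((univ.filter fun b : ↥(T.image (blk L)) => tadj K b.1 x.1 ≠ 0).card : ℝ) ≤ 2 * ((d : ℝ) + 1) := by
  classical
  have hx : x.1 ∈ boxDom (dbl K) := hTc ▸ x.2
  have key : ((univ.filter fun b : ↥(T.image (blk L)) => tadj K x.1 b.1 ≠ 0).card : ℝ) ≤ 2 * ((d : ℝ) + 1) := by
    have h1 : ((univ.filter fun b : ↥(T.image (blk L)) => tadj K x.1 b.1 ≠ 0).card : ℝ) ≤
        ∑ b : ↥(T.image (blk L)), (tadj K x.1 b.1 : ℝ) := by
      rw [Finset.card_eq_sum_ones, Nat.cast_sum, Finset.sum_filter]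
      refine Finset.sum_le_sum fun b _ => ?_
      split_ifs with h
      · exact_mod_cast Nat.one_le_iff_ne_zero.2 h
      · positivity
    have h2 : ∑ b : ↥(T.image (blk L)), (tadj K x.1 b.1 : ℝ) = 2 * ((d : ℝ) + 1) := by
      rw [Finset.sum_coe_sort (T.image (blk L)) (fun b => (tadj K x.1 b : ℝ)),
        Finset.sum_congr hTc (fun _ _ => rfl)]
      exact_mod_cast sum_tadj hK x.1
    linarith
  refine ⟨key, ?_⟩
  have e : (univ.filter fun b : ↥(T.image (blk L)) => tadj K b.1 x.1 ≠ 0) =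
      univ.filter fun b : ↥(T.image (blk L)) => tadj K x.1 b.1 ≠ 0 :=
    Finset.filter_congr fun b _ => by rw [tadj_comm (hTc ▸ b.2) hx]
  rw [e]
  exact key

end Geometry

/-! ### §2 The entries of `H_B^𝕋` at `a = 0` -/

section Entries

variable {n L : ℕ} [NeZero L] {K Nf : Fin (d + 1) → ℕ} {T : Finset (Fin (d + 1) → ℤ)}

/-- `torOpK n 0 N = n²·lap(tadj)` on the representatives. [folklore] -/
theorem torOpK_zero_eq_smul_lap (n : ℕ) {N : Fin (d + 1) → ℕ} (hN : ∀ i, 1 ≤ N i) {F : Finset (Fin (d + 1) → ℤ)}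
    (hF : F = boxDom (dbl N)) :
    torOpK n 0 N F = (n : ℝ) ^ 2 • lap (fun x y : ↥F => (tadj N x.1 y.1 : ℝ)) := by
  subst hF
  ext x y
  rw [torOpK_apply, Matrix.smul_apply, lap_apply, sum_tadj_real hN x, smul_eq_mul]
  simp

/-- the column `ℓ¹`-norm of `lap(tadj)` is at most `4(d+1)`. [folklore] -/
theorem sum_abs_lap_tadj_le {N : Fin (d + 1) → ℕ} (hN : ∀ i, 1 ≤ N i) {F : Finset (Fin (d + 1) → ℤ)}
    (hF : F = boxDom (dbl N)) (y : ↥F) : ∑ x : ↥F, |lap (fun x y : ↥F => (tadj N x.1 y.1 : ℝ)) x y| ≤ 4 * ((d : ℝ) + 1) := by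
  classical
  subst hF
  have h1 : ∀ x : ↥(boxDom (dbl N)), |lap (fun x y : ↥(boxDom (dbl N)) => (tadj N x.1 y.1 : ℝ)) x y| ≤
      (if x = y then 2 * ((d : ℝ) + 1) else 0) + (tadj N y.1 x.1 : ℝ) := by
    intro x
    rw [lap_apply, sum_tadj_real hN x, tadj_comm x.2 y.2]
    refine (abs_sub _ _).trans ?_
    have ha : (0 : ℝ) ≤ (tadj N y.1 x.1 : ℝ) := by positivity
    split_ifs
    · rw [abs_of_nonneg (by positivity), abs_of_nonneg ha]
    · rw [abs_zero, abs_of_nonneg ha]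
  refine (Finset.sum_le_sum fun x _ => h1 x).trans ?_
  rw [Finset.sum_add_distrib, Finset.sum_ite_eq' univ y, if_pos (Finset.mem_univ _), sum_tadj_real hN y]
  linarith

/-- the entries of `H_B^𝕋` as a double sum through the fine torus. [folklore] -/
theorem torB_apply (hTL : IsBlockUnion L T) (n : ℕ) (a : ℝ) (N : Fin (d + 1) → ℕ) (c c' : Idx L T) :
    torB hTL n a N c c' = ((L : ℝ) ^ (d + 1))⁻¹ *
      ∑ y' : ↥T, (∑ x' : ↥T, coordT hTL x' c * torOpK (n * L) a N T x' y') * coordT hTL y' c' := by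
  simp only [torB, chartOp, Matrix.smul_apply, smul_eq_mul, Matrix.mul_apply, transpose_apply]

/-- **THE ENTRY BOUND**: `|H_B^𝕋(c, inr q)| ≤ 8(d+1)(nL)²∕L^{d+1}` (`a = 0`). [folklore] -/
theorem abs_torB_inr_le (hNf : ∀ i, 1 ≤ Nf i) (hT : T = boxDom (dbl Nf)) (hTL : IsBlockUnion L T) (c : Idx L T)
    (q : ↥(T.image (blk L)) × NZ d L) :
    |torB hTL n 0 Nf c (Sum.inr q)| ≤ 8 * ((d : ℝ) + 1) * ((n : ℝ) * L) ^ 2 / (L : ℝ) ^ (d + 1) := by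
  have hLpow : (0 : ℝ) < (L : ℝ) ^ (d + 1) := pow_pos (by exact_mod_cast (NeZero.one_le : 1 ≤ L)) _
  rw [torB_apply, torOpK_zero_eq_smul_lap (n * L) hNf hT, abs_mul, abs_of_pos (inv_pos.2 hLpow), div_eq_mul_inv,
    mul_comm _ (((L : ℝ) ^ (d + 1))⁻¹)]
  refine mul_le_mul_of_nonneg_left ?_ (inv_pos.2 hLpow).le
  set Λ := lap (fun x y : ↥T => (tadj Nf x.1 y.1 : ℝ)) with hΛ
  have hinner : ∀ y' : ↥T, |∑ x' : ↥T, coordT hTL x' c * ((((n * L : ℕ) : ℝ)) ^ 2 • Λ) x' y'| ≤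
      4 * ((d : ℝ) + 1) * ((n : ℝ) * L) ^ 2 := by
    intro y'
    refine (Finset.abs_sum_le_sum_abs _ _).trans ?_
    have h1 : ∀ x' : ↥T, |coordT hTL x' c * ((((n * L : ℕ) : ℝ)) ^ 2 • Λ) x' y'| ≤ ((n : ℝ) * L) ^ 2 * |Λ x' y'| := by
      intro x'
      rw [abs_mul, Matrix.smul_apply, smul_eq_mul, abs_mul]
      push_cast
      rw [abs_of_nonneg (by positivity : (0 : ℝ) ≤ ((n : ℝ) * L) ^ 2)]
      calc |coordT hTL x' c| * (((n : ℝ) * L) ^ 2 * |Λ x' y'|) ≤ 1 * (((n : ℝ) * L) ^ 2 * |Λ x' y'|) :=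
            mul_le_mul_of_nonneg_right (abs_coordT_le_one hTL x' c) (by positivity)
        _ = ((n : ℝ) * L) ^ 2 * |Λ x' y'| := one_mul _
    refine (Finset.sum_le_sum fun x' _ => h1 x').trans ?_
    rw [← Finset.mul_sum]
    have := sum_abs_lap_tadj_le hNf hT y'
    nlinarith [this, sq_nonneg ((n : ℝ) * L)]
  calc |∑ y' : ↥T, (∑ x' : ↥T, coordT hTL x' c * ((((n * L : ℕ) : ℝ)) ^ 2 • Λ) x' y') * coordT hTL y' (Sum.inr q)|
      ≤ ∑ y' : ↥T, |(∑ x' : ↥T, coordT hTL x' c * ((((n * L : ℕ) : ℝ)) ^ 2 • Λ) x' y') * coordT hTL y' (Sum.inr q)| :=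
        Finset.abs_sum_le_sum_abs _ _
    _ ≤ ∑ y' : ↥T, 4 * ((d : ℝ) + 1) * ((n : ℝ) * L) ^ 2 * |coordT hTL y' (Sum.inr q)| := by
        refine Finset.sum_le_sum fun y' _ => ?_
        rw [abs_mul]
        exact mul_le_mul_of_nonneg_right (hinner y') (abs_nonneg _)
    _ ≤ 4 * ((d : ℝ) + 1) * ((n : ℝ) * L) ^ 2 * 2 := by
        rw [← Finset.mul_sum]
        exact mul_le_mul_of_nonneg_left (sum_abs_coordT_inr_le hTL q) (by positivity)
    _ = 8 * ((d : ℝ) + 1) * ((n : ℝ) * L) ^ 2 := by ring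

/-- the transposed entry bound (`H_B^𝕋` is symmetric). [folklore] -/
theorem abs_torB_inr_le' (hNf : ∀ i, 1 ≤ Nf i) (hT : T = boxDom (dbl Nf)) (hTL : IsBlockUnion L T)
    (q : ↥(T.image (blk L)) × NZ d L) (c : Idx L T) :
    |torB hTL n 0 Nf (Sum.inr q) c| ≤ 8 * ((d : ℝ) + 1) * ((n : ℝ) * L) ^ 2 / (L : ℝ) ^ (d + 1) := by
  rw [(torB_isSymm hTL hT n 0).apply c (Sum.inr q)]
  exact abs_torB_inr_le hNf hT hTL c q

/-- block labels commute with reduction: `blk_L (z mod 2LK) = (blk_L z) mod 2K`. [folklore] -/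
theorem blk_wrap_dbl (hK : ∀ i, 1 ≤ K i) (z : Fin (d + 1) → ℤ) :
    blk L (wrap (dbl fun i => L * K i) z) = wrap (dbl K) (blk L z) := by
  rw [dbl_mul, blk_wrap (NeZero.one_le : 1 ≤ L) (dbl_pos hK)]

/-- labels are coarse representatives (from the fine torus data). [folklore] -/
theorem mem_dbl_of_label' (hT : T = boxDom (dbl fun i => L * K i)) (b : ↥(T.image (blk L))) :
    b.1 ∈ boxDom (dbl K) := by
  subst hT
  rw [← image_blk_dbl (NeZero.one_le : 1 ≤ L) K]
  exact b.2

/-- **LOCALITY OF `H_B^𝕋` (`a = 0`)**: a nonzero entry `H_B^𝕋(c, c′)` forces the coarse sites to be EQUAL or TORUS-ADJACENT (the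
periodic Laplacian couples torus neighbours, whose `L`-blocks coincide or are torus-adjacent). [folklore] -/
theorem torB_zero_ne_zero_adj (hK : ∀ i, 1 ≤ K i) (hNf : Nf = fun i => L * K i) (hT : T = boxDom (dbl Nf))
    (hTL : IsBlockUnion L T) {c c' : Idx L T} (h : torB hTL n 0 Nf c c' ≠ 0) :
    site c = site c' ∨ tadj K (site c).1 (site c').1 ≠ 0 := by
  classical
  subst hNf
  have hL : 1 ≤ L := NeZero.one_le
  rw [torB_apply] at h
  have h1 := right_ne_zero_of_mul h
  obtain ⟨y', -, hy'⟩ := Finset.exists_ne_zero_of_sum_ne_zero h1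
  have hT' : coordT hTL y' c' ≠ 0 := right_ne_zero_of_mul hy'
  obtain ⟨x', -, hx'⟩ := Finset.exists_ne_zero_of_sum_ne_zero (left_ne_zero_of_mul hy')
  have hTc : coordT hTL x' c ≠ 0 := left_ne_zero_of_mul hx'
  have hM : torOpK (n * L) 0 (fun i => L * K i) T x' y' ≠ 0 := right_ne_zero_of_mul hx'
  have hxc : rblk L T x' = site c := coordT_compat hTL x' c hTc
  have hyc : rblk L T y' = site c' := coordT_compat hTL y' c' hT'
  by_cases hxy : x' = y'
  · left
    rw [← hxc, ← hyc, hxy]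
  · -- at `a = 0` a nonzero off-diagonal entry of the periodic operator means torus neighbours
    have ht : tadj (fun i => L * K i) x'.1 y'.1 ≠ 0 := by
      intro h0
      apply hM
      rw [torOpK_apply, if_neg hxy, h0]
      simp
    obtain ⟨z, hz, hzy⟩ := exists_of_tadj_ne_zero ht
    have hblk : blk L y'.1 = wrap (dbl K) (blk L z) := by rw [← hzy, blk_wrap_dbl hK]
    rcases blk_eq_or_mem_nbrs_of_mem_nbrs hL hz with heq | hnb
    · left
      rw [← hxc, ← hyc]
      apply Subtype.ext
      show blk L x'.1 = blk L y'.1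
      rw [hblk, heq]
      exact (wrap_eq_self (mem_dbl_of_label' hT (rblk L T x'))).symm
    · right
      rw [← hxc, ← hyc]
      exact tadj_ne_zero_of_exists hnb hblk.symm

/-- **THE COARSE BLOCK IS BOUNDED**: `|H_B^𝕋(x, y)| ≤ 4(d+1)·n²L²` for coarse sites `x, y` (`a = 0`; the block of `x` has `L^{d+1}`
points, each column of the periodic Laplacian has `ℓ¹`-norm `≤ 4(d+1)(nL)²`). [folklore] -/
theorem abs_torB_inl_inl_le (hNf : ∀ i, 1 ≤ Nf i) (hT : T = boxDom (dbl Nf)) (hTL : IsBlockUnion L T)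
    (x y : ↥(T.image (blk L))) :
    |torB hTL n 0 Nf (Sum.inl x) (Sum.inl y)| ≤ 4 * ((d : ℝ) + 1) * (n : ℝ) ^ 2 * (L : ℝ) ^ 2 := by
  classical
  have hL : 1 ≤ L := NeZero.one_le
  have hLpos : (0 : ℝ) < L := by exact_mod_cast hL
  have hLpow : (0 : ℝ) < (L : ℝ) ^ (d + 1) := pow_pos hLpos _
  rw [torB_apply, torOpK_zero_eq_smul_lap (n * L) hNf hT, abs_mul, abs_of_pos (inv_pos.2 hLpow)]
  set Λ := lap (fun x y : ↥T => (tadj Nf x.1 y.1 : ℝ)) with hΛ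
  -- swap the sums: `Σ_{y′}(Σ_{x′} T Λ) T = Σ_{x′} T_{x′x}·(Σ_{y′} Λ_{x′y′} T_{y′y})`; bound each inner sum by the column norm
  have hswap : ∑ y' : ↥T, (∑ x' : ↥T, coordT hTL x' (Sum.inl x) * ((((n * L : ℕ) : ℝ)) ^ 2 • Λ) x' y') *
      coordT hTL y' (Sum.inl y) =
      ∑ x' : ↥T, coordT hTL x' (Sum.inl x) * ∑ y' : ↥T, ((((n * L : ℕ) : ℝ)) ^ 2 • Λ) x' y' * coordT hTL y' (Sum.inl y) := by
    simp_rw [Finset.sum_mul, Finset.mul_sum]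
    rw [Finset.sum_comm]
    exact Finset.sum_congr rfl fun x' _ => Finset.sum_congr rfl fun y' _ => by ring
  rw [hswap]
  have hinner : ∀ x' : ↥T, |∑ y' : ↥T, ((((n * L : ℕ) : ℝ)) ^ 2 • Λ) x' y' * coordT hTL y' (Sum.inl y)| ≤
      4 * ((d : ℝ) + 1) * ((n : ℝ) * L) ^ 2 := by
    intro x'
    refine (Finset.abs_sum_le_sum_abs _ _).trans ?_
    have h1 : ∀ y' : ↥T, |((((n * L : ℕ) : ℝ)) ^ 2 • Λ) x' y' * coordT hTL y' (Sum.inl y)| ≤ ((n : ℝ) * L) ^ 2 * |Λ x' y'| := by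
      intro y'
      rw [abs_mul, Matrix.smul_apply, smul_eq_mul, abs_mul]
      push_cast
      rw [abs_of_nonneg (by positivity : (0 : ℝ) ≤ ((n : ℝ) * L) ^ 2)]
      calc ((n : ℝ) * L) ^ 2 * |Λ x' y'| * |coordT hTL y' (Sum.inl y)| ≤ ((n : ℝ) * L) ^ 2 * |Λ x' y'| * 1 :=
            mul_le_mul_of_nonneg_left (abs_coordT_le_one hTL y' _) (by positivity)
        _ = ((n : ℝ) * L) ^ 2 * |Λ x' y'| := mul_one _
    refine (Finset.sum_le_sum fun y' _ => h1 y').trans ?_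
    rw [← Finset.mul_sum]
    -- the ROW `ℓ¹`-norm equals the column norm by symmetry of `lap(tadj)`
    have hsym : ∀ y' : ↥T, Λ x' y' = Λ y' x' := by
      intro y'
      subst hT
      rw [hΛ, lap_apply, lap_apply, sum_tadj_real hNf x', sum_tadj_real hNf y', tadj_comm x'.2 y'.2]
      by_cases h : x' = y'
      · subst h; rfl
      · rw [if_neg h, if_neg (Ne.symm h)]
    simp_rw [hsym]
    have := sum_abs_lap_tadj_le hNf hT x'
    nlinarith [this, sq_nonneg ((n : ℝ) * L)]
  -- `Σ_{x′} |T_{x′x}|·(inner) ≤ L^{d+1}·4(d+1)(nL)²`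
  have hcol : ∑ x' : ↥T, |coordT hTL x' (Sum.inl x)| = (L : ℝ) ^ (d + 1) := by
    simp only [coordT_apply_inl]
    have e : ∀ x' : ↥T, |(if rblk L T x' = x then (1 : ℝ) else 0)| = if rblk L T x' = x then (1 : ℝ) else 0 := fun x' => by
      split_ifs <;> simp
    simp_rw [e]
    rw [Finset.sum_boole, card_filter_rblk hL hTL x]
    push_cast
    ring
  calc ((L : ℝ) ^ (d + 1))⁻¹ * |∑ x' : ↥T, coordT hTL x' (Sum.inl x) *
        ∑ y' : ↥T, ((((n * L : ℕ) : ℝ)) ^ 2 • Λ) x' y' * coordT hTL y' (Sum.inl y)|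
      ≤ ((L : ℝ) ^ (d + 1))⁻¹ * ∑ x' : ↥T, |coordT hTL x' (Sum.inl x)| * (4 * ((d : ℝ) + 1) * ((n : ℝ) * L) ^ 2) := by
        refine mul_le_mul_of_nonneg_left ((Finset.abs_sum_le_sum_abs _ _).trans (Finset.sum_le_sum fun x' _ => ?_))
          (inv_pos.2 hLpow).le
        rw [abs_mul]
        exact mul_le_mul_of_nonneg_left (hinner x') (abs_nonneg _)
    _ = 4 * ((d : ℝ) + 1) * (n : ℝ) ^ 2 * (L : ℝ) ^ 2 := by
        rw [← Finset.sum_mul, hcol]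
        field_simp

end Entries

end Summit.QuantumFields.BalabanUV.T4Continuum.NE7K1LinTorusEntries

end
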